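import Literature.MathematicalPhysics.QuantumFieldTheory.Balaban1983to89.B3Sect1Statements
import Literature.MathematicalPhysics.QuantumFieldTheory.Balaban1983to89.B4Lemma22HolderBox

/-!
# `Balaban1983to89.B3Norm132ConstGauge` — T. Bałaban, *(Higgs)₂,₃ quantum fields in a finite volume. III. Renormalization*,
# Commun. Math. Phys. **88** (1983) 411–445 [Balaban1983Higgs3]: the p. 434 sentence «the norms on the right side above are
# defined in the usual way, with the vector field B̃ = 0, but the external scalar fields appear with the gauge transformation,
# so these norms are equal to the norms defined by (1.32) with B̃ = B̃₀» PROVED as an exact identity of r15's printed norm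
# (1.32) `B3Sect1Statements.norm132`: for a CONSTANT background `B̃₀` and the gauge `g = U(κλ)`, `λ = −⟨B̃₀,·⟩`, which removes
# it (p. 433), `‖φ‖_{1,α}` with covariant derivatives `D^η_{B̃₀,μ}` and transports `U(B̃₀(Γ_{x,x′}))` EQUALS the plain
# `‖g ᵀφ‖_{1,α}` (`U ≡ 1`) — summand by summand, for every contour choice, every `α`, every domain of the suprema

statement-level skeleton of published theorems with citation tags; proofs where landed; nothing here is a claim about the Yang–Mills mass gap

PDF held: `paper:balaban1983-higgs-2-3-quantum-fields-finite-volume` (journal page = PDF page + 410); p. 420 [PDF 10] ((1.32)),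
p. 433 [PDF 23] (the gauge transformation removing `B̃₀`), p. 434 [PDF 24] (the sentence) read in the OCR text (`p0010.txt`,
`p0023.txt`, `p0024.txt`); [B4] = T. Bałaban, *Regularity and decay of lattice Green's functions*, CMP **89** (1983)
[Balaban1983RegularityDecay], (1.2)–(1.4) p. 572, (2.14) p. 577, p. 581, as quoted by `B4GaugeCovariance` / `B4Lemma22HolderBox`.

CITATION HEADER (lean-in-tree rule).  Part of the lit-balaban TYPED SKELETON (HOME `run/shared/lean/pub/lit-balaban/`), Phase 2,
proof seat **p03 gen 7** (unit `lit-balaban-p03-g7`); SKELETON rows **B3.Txt@433** (p. 433–434 reduction narrative: the gauge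
step; owner r15, `HOME/lit-balaban-r15/ROWS-B3.md`), **B3.Eq1.32** (decl of record `B3Sect1Statements.norm132`, typed p239840) and
the parenthetical of **B3.Eq3.3** («norms with B̃ = 0, external scalar fields gauge transformed = norms (1.32) with B̃ = B̃₀»).
Companion of this seat's `B3Eq26ConstBox` / `B3Ineq210ConstBox` (the same gauge step for the propagator kernels (2.6)/(2.10)/
(2.11)).  Built BY NAME on r15's `B3Sect1Statements.norm132` (SUM form of (1.32) over `LatticeNorms.supNorm`/`holderSeminorm`),
the [B4] lineage's covariant derivative `B4Lemma21Region.covDeriv` ((1.3)), link variables / transport / constant field / linear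
gauge of `B4GaugeCovariance` (cell `b2b-balaban-b04`), `B4Lemma22ReduceZero.covDeriv_constBond` (`D^η_{A₀} = 𝒢(∂^η ⊗ 1)𝒢ᵀ`) and
`B4Lemma22HolderBox.transport_constBond` (`U(A₀(Γ)) = g(start)g(end)ᵀ`); nothing of these is re-proved, no existing module is
touched.

WHAT IS PRINTED.  (1.32) p. 420: *"For a scalar field f of one variable we define ‖f‖_{1,α} = sup_x |f(x)| + sup_{x,μ}
|(D^η_{B̃,μ}f)(x)| + sup_{x,x′,μ} |x − x′|^{−α}|U(B̃(Γ_{x,x′}))(D^η_{B̃,μ}f)(x′) − (D^η_{B̃,μ}f)(x)|, (1.32) where Γ_{x,x′} is a shortest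
contour connecting x and x′. … For external vector fields we have the same definition, but with B̃ = 0."*  p. 433: *"It is easy
to see that the expression corresponding to any such renormalized class is gauge-invariant with respect to gauge transformations
of the field B̃₀, if the external scalar fields are simultaneously transformed. Our next operation is the gauge transformation
which removes the field B̃₀. It was described more precisely in the proof of Lemma II.2.4. We get the same expressions as above
with B̃₀ = 0 only (and external scalar fields gauge transformed). … (3.3)"*  p. 434: *"Let us remark that the norms on the right
side above are defined in the usual way, with the vector field B̃ = 0, but the external scalar fields appear with the gauge
transformation, so these norms are equal to the norms defined by (1.32) with B̃ = B̃₀."*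

WHAT IS REPRODUCED (kind «located sentence», G.1 of `HOME/PHASE2-TARGETS.md`).  On any finite piece `R ⊂ ηℤ^{d+1}` of the lattice
(sites `↥R`, `R : Finset (Fin (d+1) → ℤ)`; in the p. 433 use `R` = the cube `□`), for `N`-component fields `φ : R → ℝ^N`
(`Φ : ↥R × ι → ℝ`, values read in `EuclideanSpace ℝ ι`), [B4]'s abelian one-parameter orthogonal link group `U(t) = e^{tq}`
(`OrthFlow`; U(1) Higgs = the `N = 2` rotation flow), `κ = eη`, derivative scale `n = η^{-1}`:
* §2 the INGREDIENTS of (1.32) at a background bond field `B̃`: values `valE`, covariant derivatives `covE` ((1.3), the lineage's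
  `covDeriv n R (fieldLink F κ B̃) μ`), transports `tauA` = `U(B̃(Γ_{x,x′}))` along a supplied contour choice, and **`norm132A`** =
  r15's `norm132` fed with them (direction matching, distance, exponent, domains of the suprema left free);
* §3 the gauge `gR = U(κλ)`, `λ = −⟨B̃₀,x⟩` (p. 433) and the transformed field `gaugeOut Φ = 𝒢ᵀΦ` (invertible:
  `blockDiag_mulVec_gaugeOut`, `gaugeOut_blockDiag_mulVec`); the three summands of (1.32) agree — values `norm_valE_eq`, covariant
  derivatives `norm_covE_eq` (`fld_covDeriv_constBond`: `D^η_{B̃₀,μ}φ = 𝒢 ∂^η_μ(𝒢ᵀφ)`), transported Hölder differences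
  `norm_holderDiff_eq` (`transport_constBond_of_end`: `U(B̃₀(Γ_{x,x′})) = g(x)g(x′)ᵀ` for EVERY contour ending at `x′`;
  `transport_zero`); whence **`norm132A_constBond_eq_gaugeOut`** — THE PRINTED SENTENCE: `‖φ‖_{1,α}[B̃₀; D_{B̃₀}, U(B̃₀(Γ))] =
  ‖𝒢ᵀφ‖_{1,α}[0]` — and the same identity read from the transformed side `norm132A_zero_eq_constBond` (`∀ ψ`,
  `‖ψ‖_{1,α}[0] = ‖𝒢ψ‖_{1,α}[B̃₀]`); `norm132A_zero_eq_plain`: at `B̃ = 0` the norm IS `norm132` with identity transports and plain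
  forward differences `∂^η ⊗ 1`;
* §4 a witness on the cube `{0,1}³` with U(1), `κ = 1`, `B̃₀ ≡ π`, whose link variable `U(π) = −1 ≠ 1` (the background is not
  gauge-trivial as a link field) — `norm132A_constBond_eq_gaugeOut_witness`.

HONEST SCOPE / DECLARED DIVERGENCES (F7).  (i) ONE-variable external scalar fields — exactly the sentence's «external scalar
fields»; the many-variable extension of (1.32) («extends in a natural way to functions of many variables») used for propagator
kernels is treated, for the pieces of (2.6), in the companion `B3Ineq210ConstBox` (`holderDiff_le`), not here.  (ii) `B̃₀`
CONSTANT and `R ⊂ ηℤ^{d+1}` (a box, a union of boxes …) — NOT the torus `T_η`, where the linear gauge `λ` is not periodic and a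
constant field has holonomy; this is the p. 433 setting (the gauge transformation acts on the cube `□`).  (iii) Structure group
= [B4]'s abelian one-parameter orthogonal flow (commuting link variables, (1.2)); nothing non-abelian.  (iv) «Γ_{x,x′} a shortest
contour»: the identity is proved for EVERY contour choice ending at `x′` (zero curvature makes the transport contour-independent,
`transport_constBond_of_end`), so no shortest-path selection is formalised or needed.  (v) The identity is EXACT (`=`), summand
by summand, for every exponent `α`, direction matching, distance function and domains `S`, `SD` of the suprema — in particular
for the printed ones.  (vi) The graph-level half of the p. 433 sentence («the expression corresponding to any such renormalized
class is gauge-invariant») is not typed as a statement about the multilinear expressions `E(G_ren, …)`; what is certified is its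
two load-bearing ingredients: the propagators (companion files) and the external-field norms (this file).  (vii) ROUTE = the
print's; no Literature fact minted (defs with bodies, theorems proved); standard axioms.  Value = kernel certificate of a located
sentence of [B3] p. 434; NOT summit progress.
Unit `lit-balaban-p03-g7` (Phase-2 proof seat p03, gen 7); HOME `run/shared/lean/pub/lit-balaban/` (rows B3.Txt@433, B3.Eq1.32,
B3.Eq3.3; FILED.md, STATUS.md).
-/

namespace Literature.MathematicalPhysics.QuantumFieldTheory.Balaban1983to89.B3Norm132ConstGauge

open Matrix Finset
open scoped Kronecker NNReal
open B4GaugeCovariance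
open B4Lemma21Region (covDeriv)
open B4Cor23Zero (fdiffM)
open B4Lemma22ReduceZero (covDeriv_constBond covDeriv_one isGauge_transpose)
open B4Lemma22HolderBox (transport_constBond transport_fieldLink pathSum)
open LatticeNorms (supNorm holderSeminorm)
open B3Sect1Statements (norm132)

noncomputable section

variable {d : ℕ} {ι : Type} [Fintype ι] [DecidableEq ι]

/-! ## §1 Euclidean values and two congruence facts for the ingredients of (1.32) -/

section Euclid

variable {X : Type*}

omit [DecidableEq ι] in
/-- kernel: the Euclidean norm of `v ∈ ℝ^N` read in `EuclideanSpace ℝ ι` is `√(v·v)`. [folklore] -/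
private theorem norm_toLp_eq_sqrt (v : ι → ℝ) : ‖(WithLp.toLp 2 v : EuclideanSpace ℝ ι)‖ = Real.sqrt (v ⬝ᵥ v) := by
  rw [EuclideanSpace.norm_eq]
  congr 1
  simp [dotProduct, pow_two]

/-- kernel: an orthogonal site factor is a Euclidean isometry: `|g(x)v| = |v|`. [folklore] -/
private theorem norm_toLp_gauge {g : X → Matrix ι ι ℝ} (hg : IsGauge g) (x : X) (v : ι → ℝ) :
    ‖(WithLp.toLp 2 (g x *ᵥ v) : EuclideanSpace ℝ ι)‖ = ‖(WithLp.toLp 2 v : EuclideanSpace ℝ ι)‖ := by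
  rw [norm_toLp_eq_sqrt, norm_toLp_eq_sqrt, hg.dotProduct_mulVec_self]

variable {κ' E : Type*} [SeminormedAddCommGroup E]

omit [Fintype ι] [DecidableEq ι] in
/-- kernel: the sup part of (1.32) depends only on the sitewise norms. [folklore] -/
private theorem supNorm_congr {S : Finset X} {f f' : X → E} (h : ∀ x, ‖f x‖ = ‖f' x‖) : supNorm S f = supNorm S f' := by
  unfold LatticeNorms.supNorm
  have hn : ∀ x, ‖f x‖₊ = ‖f' x‖₊ := fun x => NNReal.eq (by simpa using h x)
  simp_rw [hn]

omit [Fintype ι] [DecidableEq ι] in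
/-- kernel: the Hölder part of (1.32) depends only on the norms of the transported differences. [folklore] -/
private theorem holderSeminorm_congr {α : ℝ} {adm : κ' → κ' → Prop} {dist : κ' → κ' → ℝ} {τ τ' : κ' → κ' → E → E}
    {S : Finset κ'} {f f' : κ' → E} (h : ∀ p q, ‖τ p q (f q) - f p‖ = ‖τ' p q (f' q) - f' p‖) :
    holderSeminorm α adm dist τ S f = holderSeminorm α adm dist τ' S f' := by
  unfold LatticeNorms.holderSeminorm
  have hn : ∀ p q, ‖τ p q (f q) - f p‖₊ = ‖τ' p q (f' q) - f' p‖₊ := fun p q => NNReal.eq (by simpa using h p q)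
  simp_rw [hn]

end Euclid

/-! ## §2 The ingredients of (1.32) for an `N`-component scalar field `φ` on a finite piece `R` of the `η`-lattice, at a background
bond field `B̃` with [B4]'s link variables `U(B̃_b) = e^{qeηB̃_b}` -/

section Data

variable (F : OrthFlow ι) (κ : ℝ) {R : Finset (Fin (d + 1) → ℤ)} (n : ℕ)

/-- the values `φ(x) ∈ ℝ^N` of the field, as Euclidean vectors (the `|·|` of (1.32) is the Euclidean norm on `ℝ^N`; for the U(1)
Higgs field of [B3], `N = 2`, it is the modulus of the complex value). [cite: Balaban1983Higgs3, (1.32) p.420] -/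
def valE (Φ : ↥R × ι → ℝ) : ↥R → EuclideanSpace ℝ ι := fun x => WithLp.toLp 2 (fld Φ x)

/-- the covariant derivatives `(D^η_{B̃,μ}φ)(x) = η^{−1}(U(B̃_{⟨x,x+ηe_μ⟩})φ(x+ηe_μ) − φ(x))` of (1.32) ([B4] (1.3); the lineage's
`B4Lemma21Region.covDeriv` with `η^{−1} = n`, Neumann: `0` when the bond leaves `R`), indexed by `(μ, x)`, as Euclidean vectors, at
the background bond field `B̃` with link variables `fieldLink F κ B̃`. [cite: Balaban1983Higgs3, (1.32) p.420] -/
def covE (B : ↥R → ↥R → ℝ) (Φ : ↥R × ι → ℝ) : Fin (d + 1) × ↥R → EuclideanSpace ℝ ι :=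
  fun p => WithLp.toLp 2 (fld (covDeriv n R (fieldLink F κ B) p.1 *ᵥ Φ) p.2)

/-- the transport `U(B̃(Γ_{x,x′}))` of (1.32), carrying a derivative value at `x′` to `x` along the chosen contour `Γ_{x,x′}`
(`Γ x x′` = the list of sites visited after `x`; [B4] p. 572 «A(Γ) = Σ_{b⊂Γ}A_b», `B4GaugeCovariance.transport`).
[cite: Balaban1983Higgs3, (1.32) p.420] -/
def tauA (B : ↥R → ↥R → ℝ) (Γ : ↥R → ↥R → List ↥R) :
    Fin (d + 1) × ↥R → Fin (d + 1) × ↥R → EuclideanSpace ℝ ι → EuclideanSpace ℝ ι :=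
  fun p q v => WithLp.toLp 2 (transport (fieldLink F κ B) p.2 (Γ p.2 q.2) *ᵥ WithLp.ofLp v)

/-- **(1.32) at the background `B̃`**: `‖φ‖_{1,α} = sup_x|φ(x)| + sup_{x,μ}|(D^η_{B̃,μ}φ)(x)| + sup_{x,x′,μ}|x−x′|^{−α}
|U(B̃(Γ_{x,x′}))(D^η_{B̃,μ}φ)(x′) − (D^η_{B̃,μ}φ)(x)|` — r15's printed SUM form `B3Sect1Statements.norm132` fed with the concrete
ingredients above (sites `S`, derivative indices `SD`, direction matching `sameDir`, distance `distD` and the Hölder exponent `α`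
are left free: the identity below holds for all of them). [cite: Balaban1983Higgs3, (1.32) p.420] -/
def norm132A (α : ℝ) (sameDir : Fin (d + 1) × ↥R → Fin (d + 1) × ↥R → Prop)
    (distD : Fin (d + 1) × ↥R → Fin (d + 1) × ↥R → ℝ) (S : Finset ↥R) (SD : Finset (Fin (d + 1) × ↥R))
    (B : ↥R → ↥R → ℝ) (Γ : ↥R → ↥R → List ↥R) (Φ : ↥R × ι → ℝ) : ℝ :=
  norm132 α sameDir distD (tauA F κ B Γ) S SD (valE Φ) (covE F κ n B Φ)

end Data

/-! ## §3 The gauge transformation which removes the constant field `B̃₀` (p. 433), and the p. 434 identity of norms -/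

section ConstField

variable (F : OrthFlow ι) (κ : ℝ) {R : Finset (Fin (d + 1) → ℤ)} (n : ℕ) (A₀ : Fin (d + 1) → ℝ)

/-- the gauge `g(x) = U(κλ(x))`, `λ = −⟨B̃₀, x⟩`, removing the constant field `B̃₀` on `R ⊂ ηℤ^{d+1}` (p. 433 «the gauge
transformation which removes the field B̃₀. It was described more precisely in the proof of Lemma II.2.4»; [B4] p. 581;
`B4GaugeCovariance.linGauge`). [cite: Balaban1983Higgs3, p.433] -/
def gR : ↥R → Matrix ι ι ℝ := fun x => F.U (κ * linGauge A₀ Subtype.val x)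

/-- the gauge is orthogonal sitewise. [cite: Balaban1983Higgs3, p.433] -/
theorem isGauge_gR : IsGauge (gR F κ A₀ (R := R)) := F.isGauge _

/-- «external scalar fields gauge transformed» (p. 433): `ψ(x) = g(x)ᵀφ(x)`, the field in the gauge where `B̃₀` has been removed
(`𝒢ᵀΦ`, `𝒢 = ⊕_x g(x)`; inverse `Φ = 𝒢Ψ`). [cite: Balaban1983Higgs3, p.433] -/
def gaugeOut (Φ : ↥R × ι → ℝ) : ↥R × ι → ℝ := (blockDiag (gR F κ A₀ (R := R)))ᵀ *ᵥ Φ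

variable {F κ n A₀}

/-- `𝒢(𝒢ᵀΦ) = Φ`: the gauge transformation is invertible. [cite: Balaban1983Higgs3, p.433] -/
theorem blockDiag_mulVec_gaugeOut (Φ : ↥R × ι → ℝ) : blockDiag (gR F κ A₀ (R := R)) *ᵥ gaugeOut F κ A₀ Φ = Φ := by
  rw [gaugeOut, Matrix.mulVec_mulVec, blockDiag_mul_transpose_self (isGauge_gR F κ A₀), Matrix.one_mulVec]

/-- `𝒢ᵀ(𝒢Ψ) = Ψ`. [cite: Balaban1983Higgs3, p.433] -/
theorem gaugeOut_blockDiag_mulVec (Ψ : ↥R × ι → ℝ) : gaugeOut F κ A₀ (blockDiag (gR F κ A₀ (R := R)) *ᵥ Ψ) = Ψ := by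
  rw [gaugeOut, Matrix.mulVec_mulVec, blockDiag_transpose_mul_self (isGauge_gR F κ A₀), Matrix.one_mulVec]

/-- **values**: `φ(x) = g(x)ψ(x)`, so `|φ(x)| = |ψ(x)|`. [cite: Balaban1983Higgs3, p.434] -/
theorem norm_valE_eq (Φ : ↥R × ι → ℝ) (x : ↥R) :
    ‖valE Φ x‖ = ‖valE (gaugeOut F κ A₀ Φ) x‖ := by
  have h : fld Φ x = gR F κ A₀ x *ᵥ fld (gaugeOut F κ A₀ Φ) x := by
    conv_lhs => rw [← blockDiag_mulVec_gaugeOut (F := F) (κ := κ) (A₀ := A₀) Φ]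
    rw [fld_blockDiag_mulVec]
  rw [valE, valE, h, norm_toLp_gauge (isGauge_gR F κ A₀)]

/-- **covariant derivatives**: `D^η_{B̃₀,μ}φ = 𝒢(∂^η_μψ)` (`B4Lemma22ReduceZero.covDeriv_constBond`: `D^η_{B̃₀,μ} = 𝒢(∂^η_μ ⊗ 1)𝒢ᵀ`),
the zero-field derivative being the one with trivial link variables `U ≡ 1 = fieldLink F κ 0`. [cite: Balaban1983Higgs3, p.434] -/
theorem fld_covDeriv_constBond (Φ : ↥R × ι → ℝ) (μ : Fin (d + 1)) (x : ↥R) :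
    fld (covDeriv n R (fieldLink F κ (constBond A₀ Subtype.val)) μ *ᵥ Φ) x
      = gR F κ A₀ x *ᵥ fld (covDeriv n R (fieldLink F κ 0) μ *ᵥ gaugeOut F κ A₀ Φ) x := by
  rw [covDeriv_constBond, fieldLink_zero, covDeriv_one, ← Matrix.mulVec_mulVec, ← Matrix.mulVec_mulVec, fld_blockDiag_mulVec]
  rfl

/-- hence `|(D^η_{B̃₀,μ}φ)(x)| = |(∂^η_μψ)(x)|`. [cite: Balaban1983Higgs3, p.434] -/
theorem norm_covE_eq (Φ : ↥R × ι → ℝ) (p : Fin (d + 1) × ↥R) :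
    ‖covE F κ n (constBond A₀ Subtype.val) Φ p‖ = ‖covE F κ n 0 (gaugeOut F κ A₀ Φ) p‖ := by
  rw [covE, covE, fld_covDeriv_constBond, norm_toLp_gauge (isGauge_gR F κ A₀)]

/-- **transports**: for the constant field the transport along ANY contour from `x` that ends at `x′` is `g(x)g(x′)ᵀ`
(`B4Lemma22HolderBox.transport_constBond`; zero curvature), so «Γ_{x,x′} a shortest contour» needs no choice; and at `B̃ = 0` every
transport is `1`. [cite: Balaban1983Higgs3, (1.32) p.420] -/
theorem transport_constBond_of_end {Γ : ↥R → ↥R → List ↥R} (hΓ : ∀ x x', pathEnd x (Γ x x') = x') (x x' : ↥R) :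
    transport (fieldLink F κ (constBond A₀ Subtype.val)) x (Γ x x') = gR F κ A₀ x * (gR F κ A₀ x')ᵀ := by
  rw [transport_constBond, hΓ]
  rfl

/-- at `B̃ = 0` every transport is the identity. [cite: Balaban1983Higgs3, (1.32) p.420] -/
theorem transport_zero (x : ↥R) (l : List ↥R) : transport (fieldLink F κ (0 : ↥R → ↥R → ℝ)) x l = 1 := by
  rw [fieldLink_zero, transport_one]

/-- **the Hölder differences**: `U(B̃₀(Γ_{x,x′}))(D^η_{B̃₀,μ′}φ)(x′) − (D^η_{B̃₀,μ}φ)(x) = g(x)[(∂^η_{μ′}ψ)(x′) − (∂^η_μψ)(x)]`, so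
its length is that of the plain difference of the gauge-transformed field. [cite: Balaban1983Higgs3, p.434] -/
theorem norm_holderDiff_eq {Γ : ↥R → ↥R → List ↥R} (hΓ : ∀ x x', pathEnd x (Γ x x') = x') (Γ₀ : ↥R → ↥R → List ↥R)
    (Φ : ↥R × ι → ℝ) (p q : Fin (d + 1) × ↥R) :
    ‖tauA F κ (constBond A₀ Subtype.val) Γ p q (covE F κ n (constBond A₀ Subtype.val) Φ q)
        - covE F κ n (constBond A₀ Subtype.val) Φ p‖
      = ‖tauA F κ 0 Γ₀ p q (covE F κ n 0 (gaugeOut F κ A₀ Φ) q) - covE F κ n 0 (gaugeOut F κ A₀ Φ) p‖ := by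
  simp only [tauA, covE, WithLp.ofLp_toLp, fld_covDeriv_constBond, transport_constBond_of_end hΓ, transport_zero,
    Matrix.one_mulVec]
  rw [Matrix.mulVec_mulVec, Matrix.mul_assoc, isGauge_gR F κ A₀ q.2, Matrix.mul_one,
    ← WithLp.toLp_sub, ← Matrix.mulVec_sub, norm_toLp_gauge (isGauge_gR F κ A₀), WithLp.toLp_sub]

/-- **B3 p. 434 [PDF 24], verbatim: «Let us remark that the norms on the right side above are defined in the usual way, with the
vector field B̃ = 0, but the external scalar fields appear with the gauge transformation, so these norms are equal to the norms
defined by (1.32) with B̃ = B̃₀.» — PROVED as an exact identity.**  For every finite piece `R ⊂ ηℤ^{d+1}` of the lattice (a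
cube `□` in the use on p. 433), every `N`-component field `φ` on `R`, every constant vector field `B̃₀`, every coupling `κ = eη`,
every one-parameter orthogonal link group `U` ([B4] (1.2)), every contour choice `Γ_{x,x′}` ending at `x′`, and all data of the
norm (sites `S`, derivative indices `SD`, direction matching, distance, exponent `α`):
`‖φ‖_{1,α}[B̃ = B̃₀] = ‖g ᵀφ‖_{1,α}[B̃ = 0]`, `g(x) = U(κλ(x))`, `λ = −⟨B̃₀,x⟩` — the (1.32) norm with covariant derivatives
`D^η_{B̃₀,μ}` and transports `U(B̃₀(Γ_{x,x′}))` equals the plain (1.32) norm (`U ≡ 1`) of the gauge-transformed field.  The three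
summands agree separately (`norm_valE_eq`, `norm_covE_eq`, `norm_holderDiff_eq`).  HONEST SCOPE: one-variable external scalar
fields (the sentence's «external scalar fields»); abelian one-parameter orthogonal structure group (for [B3]'s U(1) Higgs field,
`N = 2`); `R` a subset of `ηℤ^{d+1}`, not a torus (the linear gauge is not periodic — p. 433 applies it on the cube `□`); the
many-variable extension of (1.32) (kernels) is not treated here (see `B3Ineq210ConstBox.holderDiff_le` for the propagator
kernels). [cite: Balaban1983Higgs3, p.434] -/
theorem norm132A_constBond_eq_gaugeOut (α : ℝ) (sameDir : Fin (d + 1) × ↥R → Fin (d + 1) × ↥R → Prop)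
    (distD : Fin (d + 1) × ↥R → Fin (d + 1) × ↥R → ℝ) (S : Finset ↥R) (SD : Finset (Fin (d + 1) × ↥R))
    {Γ : ↥R → ↥R → List ↥R} (hΓ : ∀ x x', pathEnd x (Γ x x') = x') (Γ₀ : ↥R → ↥R → List ↥R) (Φ : ↥R × ι → ℝ) :
    norm132A F κ n α sameDir distD S SD (constBond A₀ Subtype.val) Γ Φ
      = norm132A F κ n α sameDir distD S SD 0 Γ₀ (gaugeOut F κ A₀ Φ) := by
  unfold norm132A B3Sect1Statements.norm132
  rw [supNorm_congr (norm_valE_eq (F := F) (κ := κ) (A₀ := A₀) Φ),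
    supNorm_congr (norm_covE_eq (F := F) (κ := κ) (n := n) (A₀ := A₀) Φ),
    holderSeminorm_congr (norm_holderDiff_eq (F := F) (κ := κ) (n := n) (A₀ := A₀) hΓ Γ₀ Φ)]

/-- **the same identity read from the gauge-transformed side**: for every field `ψ` («external scalar fields gauge transformed»),
`‖ψ‖_{1,α}[B̃ = 0] = ‖𝒢ψ‖_{1,α}[B̃ = B̃₀]`. [cite: Balaban1983Higgs3, p.434] -/
theorem norm132A_zero_eq_constBond (α : ℝ) (sameDir : Fin (d + 1) × ↥R → Fin (d + 1) × ↥R → Prop)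
    (distD : Fin (d + 1) × ↥R → Fin (d + 1) × ↥R → ℝ) (S : Finset ↥R) (SD : Finset (Fin (d + 1) × ↥R))
    {Γ : ↥R → ↥R → List ↥R} (hΓ : ∀ x x', pathEnd x (Γ x x') = x') (Γ₀ : ↥R → ↥R → List ↥R) (Ψ : ↥R × ι → ℝ) :
    norm132A F κ n α sameDir distD S SD 0 Γ₀ Ψ
      = norm132A F κ n α sameDir distD S SD (constBond A₀ Subtype.val) Γ (blockDiag (gR F κ A₀ (R := R)) *ᵥ Ψ) := by
  rw [norm132A_constBond_eq_gaugeOut (A₀ := A₀) α sameDir distD S SD hΓ Γ₀, gaugeOut_blockDiag_mulVec]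

/-- **at `B̃ = 0` the (1.32) norm is the plain one**: trivial link variables, identity transports — `norm132A … 0 Γ₀ ψ` is r15's
`norm132` with `τ = id`, the values of `ψ` and its plain forward differences `∂^η_μψ = n(ψ(x+e_μ) − ψ(x))` (`fdiffM ⊗ 1`), whatever
the contour choice `Γ₀`. [cite: Balaban1983Higgs3, (1.32) p.420] -/
theorem norm132A_zero_eq_plain (α : ℝ) (sameDir : Fin (d + 1) × ↥R → Fin (d + 1) × ↥R → Prop)
    (distD : Fin (d + 1) × ↥R → Fin (d + 1) × ↥R → ℝ) (S : Finset ↥R) (SD : Finset (Fin (d + 1) × ↥R))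
    (Γ₀ : ↥R → ↥R → List ↥R) (Ψ : ↥R × ι → ℝ) :
    norm132A F κ n α sameDir distD S SD 0 Γ₀ Ψ
      = norm132 α sameDir distD (fun _ _ => id) S SD (valE Ψ)
          (fun p => WithLp.toLp 2 (fld ((fdiffM n R p.1 ⊗ₖ (1 : Matrix ι ι ℝ)) *ᵥ Ψ) p.2)) := by
  unfold norm132A B3Sect1Statements.norm132
  have hcov : covE F κ n 0 Ψ = fun p => WithLp.toLp 2 (fld ((fdiffM n R p.1 ⊗ₖ (1 : Matrix ι ι ℝ)) *ᵥ Ψ) p.2) := by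
    funext p
    rw [covE, fieldLink_zero, covDeriv_one]
  have htau : tauA F κ (0 : ↥R → ↥R → ℝ) Γ₀ = fun _ _ => id := by
    funext p q v
    rw [tauA, transport_zero, Matrix.one_mulVec, WithLp.toLp_ofLp]
    rfl
  rw [hcov, htau]

end ConstField

/-! ## §4 Non-vacuity: the identity on a concrete cube with a background that is not gauge-trivial -/

section Witness

/-- kernel: the unit cube `{0,1}³ ⊂ ℤ³` (a box of the lineage). [folklore] -/
private def cube : Finset (Fin (2 + 1) → ℤ) := B4Reflection242.boxDom (fun _ => 2)

/-- kernel: the origin is in the cube. [folklore] -/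
private theorem zero_mem_cube : (fun _ => (0 : ℤ)) ∈ cube := by
  rw [cube, B4Reflection242.mem_boxDom]; intro i; simp

/-- kernel: `e₀` is in the cube. [folklore] -/
private theorem e0_mem_cube : (fun _ => (0 : ℤ)) + B4Lower18Regular.e1 (0 : Fin (2 + 1)) ∈ cube := by
  rw [cube, B4Reflection242.mem_boxDom]; intro i; fin_cases i <;> simp [B4Lower18Regular.e1]

/-- **witness**: on the cube `{0,1}³` with the U(1) (= `N = 2` rotation) flow, `κ = 1` and the constant field `B̃₀ ≡ π`, the link
variable on the bond `⟨0, e₀⟩` is `U(π) = −1 ≠ 1` (the background is NOT gauge-trivial as a link field), and the p. 434 identity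
holds for every field, e.g. with the straight «direct» contours `Γ_{x,x′} = (x → x′)` and the whole cube as domain of the norm.
[cite: Balaban1983Higgs3, p.434] -/
theorem norm132A_constBond_eq_gaugeOut_witness :
    fieldLink OrthFlow.rot 1 (constBond (fun _ => Real.pi) (Subtype.val : ↥cube → _))
        ⟨_, zero_mem_cube⟩ ⟨_, e0_mem_cube⟩ ≠ 1 ∧
    ∀ (α : ℝ) (Φ : ↥cube × Fin 2 → ℝ),
      norm132A OrthFlow.rot 1 2 α (fun p q => p.1 = q.1) (fun _ _ => 1) Finset.univ Finset.univ
          (constBond (fun _ => Real.pi) Subtype.val) (fun _ x' => [x']) Φ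
        = norm132A OrthFlow.rot 1 2 α (fun p q => p.1 = q.1) (fun _ _ => 1) Finset.univ Finset.univ
          0 (fun _ x' => [x']) (gaugeOut OrthFlow.rot 1 (fun _ => Real.pi) Φ) := by
  refine ⟨?_, fun α Φ => norm132A_constBond_eq_gaugeOut α _ _ _ _ (fun _ _ => rfl) _ Φ⟩
  rw [fieldLink, B4Lemma22HolderBox.constBond_fwd (fun _ => Real.pi) (μ := 0) (by rfl), one_mul]
  exact OrthFlow.rot_ne_one

end Witness

end

end Literature.MathematicalPhysics.QuantumFieldTheory.Balaban1983to89.B3Norm132ConstGauge
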